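import Summits.BirchSwinnertonDyer.BirchSwinnertonDyer.Theorems.KolyvaginRoadThreeMethod2InductionOfLevelSystemsDict
import Summits.BirchSwinnertonDyer.BirchSwinnertonDyer.Theorems.KolyvaginRoadThreeMethod2LocalDictionaries
import Summits.BirchSwinnertonDyer.BirchSwinnertonDyer.Theorems.KolyvaginRoadThreeMethod2TransverseStrict
import Summits.BirchSwinnertonDyer.BirchSwinnertonDyer.Theorems.KolyvaginRoadThreeMethod2ChebOfMcCallum
import HarnessLib

/-!
# KOLY method line, crux stmt-BirchSwinnertonDyer-19574 `ZhangSharpFrameAtThreeHL`: the registered v3 stub S2-ENGINE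
# (`stub_inductionOfLevelSystemsAtThree`) — its ONE input (koly g14 `inductionOfLevelSystems_of_triangulation`, binder `hT`:
# Zhang's Lemma 8.4 triangulation at ONE good non-empty level) REDUCED to the local Tate-pairing package + (Line) + (Supply)
# over the GENUINE localisation maps, with the ordinary isotropy asked ONLY above GOOD unipotent-admissible primes
# (cell `bsd-stepL`, seat `bsd-stepL-zhang3-p1` g9; `--supports 19574`, helper)

HONEST FRAMING. One theorem; 0 definitions, 0 named facts, 0 `sorry`; CONDITIONAL on every binder; closes nothing (T7).
PARTITION: O2@3 (B10) × A1 × crux 19574 × stub S2-ENGINE — types-the-object-of.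

WHY (repair of the g8 capstone's currency). `Method2.inductionOfLevelSystems_of_localGlobal` (p502470) asks the isotropy of
the ORDINARY condition `ordinaryLocalKer` at EVERY finite place; at a place `v` whose Frobenius acts trivially on `E[3]`
(every Kolyvagin prime; every unipotent-admissible `q` with scalar `Frob_q`) `E[3]^{Γ_v} = E[3]`, so `ordinaryLocalKer_v =
⊤` and that binder would make `loc_v (H¹(K, E[3]))` isotropic — incompatible with (Perf) + (Supply). The engine USES the
isotropy of the level structure only at GOOD levels (`ZhangTriangulation.triangulation_finite … (hisoL n) …` under
`Good n`), where every level prime `q ∈ n` has `Frob_q² ≠ 1` on `E[3]` (`FrobSqNeOneAt`), `h⁰(K_v, E[3]) = 1` (koly g13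
`natCard_invariants_le_three_of_frobSqNeOneAt`) and the ordinary line IS isotropic (koly g13
`weilCupProduct_res_eq_zero_of_mem_ordinaryLocalKer`). So the honest reduction is LEVEL-WISE, and it plugs into the OWNER
seat's reduction of S2-ENGINE to the single input `hT` (koly g14 `Method2EngineOfTriangulation.inductionOfLevelSystems_of_
triangulation`, p-number in the tree): `hT` at a frame = THIS theorem at every good non-empty level.

WHAT. `Method2.triangulation_of_localGlobal`: at an HL-type frame (`K` imaginary quadratic, `c ≠ 1`, `ρ̄_{E,3}` onto,
multiplicative reduction at `3`), for a `LevelKolyvaginSystem S` and ONE good non-empty level `n` carrying a non-zero class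
`S.κ m n`, the (A3) shape of the engine — `∃ s d, dim SelQ_n^s = d + 1 ∧ SelQ_n^s = SelRelQ_{n,B}^s ∧ SelRelQ_{n,B}^{¬s}`
finite of `dim ≤ d`, `B = baseLocusQ S.κ n` — GIVEN ONLY: the genuine localisations `loc v = galoisCohomology.localization`
(as `ZMod 3`-linear maps, `hloc`), places `plK` ∕ `plU` of the Kolyvagin ∕ unipotent-admissible primes, a family of
`ZMod 3`-bilinear local forms `b v` on `H¹(K_v, E[3])` with (REC) `hrec`, Kummer isotropy `hisoKum`, ordinary isotropy
ABOVE GOOD unipotent-admissible primes `hisoOrd`, transverse isotropy `hisoTr` and (Perf) `hperf` at Kolyvagin primes,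
(Line) `hline`, and (Supply) `hSupply` AT THE LEVEL `n`. Proof = the dictionary layer (p499103) and the capstone
(p502470) specialised at the level `n` (per-place dictionaries p501309, `torsionLocalKer ≤ transverseLocalKer` p501858,
(Cheb) ×2 p500469 from McCallum's Cor. 3.2), ending in `ZhangTriangulation.triangulation_finite` (p493507).

References: [cite: WZhang2014, §8.1, Lemma 8.1, Lemma 8.2, Lemma 8.4] [cite: McCallumLMS1991, Prop. 3.1, Cor. 3.2,
Lemma 5.3] [cite: MilneADT2006, Ch. I, Cor. 2.3, Thm. 4.10] [cite: PoonenRains2012, Prop. 4.10].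
-/

noncomputable section

open scoped Classical

namespace Summit.BirchSwinnertonDyer.Rank1Residual.X11b.Three.Koly.Method2

open WeierstrassCurve NumberField IsDedekindDomain
  Literature.NumberTheory.EllipticCurves Literature.NumberTheory.EllipticCurves.ModularForms
  Literature.NumberTheory.GaloisRepresentations Module

variable (W : WeierstrassCurve ℚ) (K : Type) [Field K] [NumberField K]
variable [W.IsElliptic] [W.IsGloballyMinimal] [NeZero (W.conductorNorm ℤ)]
  (Dt : ModularParametrizationData W (W.conductorNorm ℤ)) (β : ℤ) (ι : K →+* ℂ) (c : K ≃ₐ[ℚ] K)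
  [Module (ZMod 3) (V3 W K)]
  [∀ v : Place K, Module (ZMod 3)
    (galoisCohomology (((W.baseChange K).torsionGaloisModule ((3 ^ 1 : ℕ) : ℤ)).toLocal v) 1)]

/-- **Zhang's Lemma 8.4 triangulation at ONE good non-empty level, from the local Tate-pairing package + (Line) +
(Supply) over the genuine localisations.** See the module docstring. Binders: frame facts `hK`, `hmult`, `hsurj`, `hc`;
the level system `S`; the localisations `loc` with `hloc : loc v x = galoisCohomology.localization ρ v 1 x`; the places
`plK`, `plU` (`hplK`, `hplU`); bilinear local forms `b` with (REC) `hrec`, isotropies `hisoKum`, `hisoOrd` (ONLY above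
GOOD unipotent-admissible primes: `FrobSqNeOneAt W 3 q`), `hisoTr`, (Perf) `hperf`; (Line) `hline`; the level `n` (good,
non-empty, carrying a non-zero class `hne`); (Supply) `hSupply` for the level-`n` structure (Kummer at the infinite places
and at the finite places above no prime of `n`, ordinary above `n`, transverse on `T`, free at `ℓ`). Conclusion: the
engine's (A3) shape for `SelQ n` ∕ `SelRelQ n (baseLocusQ S.κ n)` = the body of koly g14's binder `hT` at `(S, n)`.
[cite: WZhang2014, Lemma 8.4 (1)+(3), §8.1] [cite: MilneADT2006, Ch. I, Thm. 4.10] -/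
theorem triangulation_of_localGlobal (hK : IsImaginaryQuadratic K)
    (hmult : W.HasMultiplicativeReductionAtPrime 3) (hsurj : W.HasSurjectiveModNGaloisRep 3) (hc : c ≠ 1)
    (S : LevelKolyvaginSystem W K Dt β ι c)
    -- the genuine localisations, as `ZMod 3`-linear maps
    (loc : (v : Place K) → V3 W K →ₗ[ZMod 3]
      galoisCohomology (((W.baseChange K).torsionGaloisModule ((3 ^ 1 : ℕ) : ℤ)).toLocal v) 1)
    (hloc : ∀ (v : Place K) (x : V3 W K),
      loc v x = galoisCohomology.localization ((W.baseChange K).torsionGaloisModule ((3 ^ 1 : ℕ) : ℤ)) v 1 x)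
    -- the places of the Kolyvagin ∕ unipotent-admissible primes
    (plK : {ℓ // Zhang2014.IsKolyvaginPrime (W.conductorNorm ℤ) W K 3 ℓ} → HeightOneSpectrum (𝓞 K))
    (plU : {q // IsUAdmissiblePrime W K q} → HeightOneSpectrum (𝓞 K))
    (hplK : ∀ ℓ, ((ℓ : ℕ) : 𝓞 K) ∈ (plK ℓ).asIdeal) (hplU : ∀ q, ((q : ℕ) : 𝓞 K) ∈ (plU q).asIdeal)
    -- the local Tate-pairing package
    (b : (v : Place K) →
      galoisCohomology (((W.baseChange K).torsionGaloisModule ((3 ^ 1 : ℕ) : ℤ)).toLocal v) 1 →ₗ[ZMod 3]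
      galoisCohomology (((W.baseChange K).torsionGaloisModule ((3 ^ 1 : ℕ) : ℤ)).toLocal v) 1 →ₗ[ZMod 3] ZMod 3)
    (hrec : ∀ (x y : V3 W K) (T : Finset (Place K)), (∀ v, v ∉ T → b v (loc v x) (loc v y) = 0) →
      ∑ v ∈ T, b v (loc v x) (loc v y) = 0)
    (hisoKum : ∀ (v : Place K),
      ∀ x ∈ (W.baseChange K).kummerLocalConditionAt ((3 ^ 1 : ℕ) : ℤ) (Place.Completion v),
      ∀ y ∈ (W.baseChange K).kummerLocalConditionAt ((3 ^ 1 : ℕ) : ℤ) (Place.Completion v), b v x y = 0)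
    (hisoOrd : ∀ (q : {q // IsUAdmissiblePrime W K q}), FrobSqNeOneAt W 3 q.1 →
      ∀ (v : HeightOneSpectrum (𝓞 K)), ((q : ℕ) : 𝓞 K) ∈ v.asIdeal → ∀ (x y : V3 W K),
      x ∈ (W.baseChange K).ordinaryLocalKer (v.adicCompletion K) ((3 ^ 1 : ℕ) : ℤ) →
      y ∈ (W.baseChange K).ordinaryLocalKer (v.adicCompletion K) ((3 ^ 1 : ℕ) : ℤ) →
      b (Sum.inr v) (loc (Sum.inr v) x) (loc (Sum.inr v) y) = 0)
    (hisoTr : ∀ (ℓ : {ℓ // Zhang2014.IsKolyvaginPrime (W.conductorNorm ℤ) W K 3 ℓ}) (x y : V3 W K),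
      x ∈ transverseLocalKer W K ι ℓ (plK ℓ) → y ∈ transverseLocalKer W K ι ℓ (plK ℓ) →
      b (Sum.inr (plK ℓ)) (loc (Sum.inr (plK ℓ)) x) (loc (Sum.inr (plK ℓ)) y) = 0)
    (hperf : ∀ (ℓ : {ℓ // Zhang2014.IsKolyvaginPrime (W.conductorNorm ℤ) W K 3 ℓ}) (s : Bool) (x y : V3 W K),
      conjAct W c ((3 ^ 1 : ℕ) : ℤ) x = sgn s • x → conjAct W c ((3 ^ 1 : ℕ) : ℤ) y = sgn s • y →
      x ∈ selmerLocalKer (W.baseChange K) ((plK ℓ).adicCompletion K) ((3 ^ 1 : ℕ) : ℤ) →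
      x ∉ (W.baseChange K).torsionLocalKer ((plK ℓ).adicCompletion K) ((3 ^ 1 : ℕ) : ℤ) →
      y ∈ transverseLocalKer W K ι ℓ (plK ℓ) →
      y ∉ (W.baseChange K).torsionLocalKer ((plK ℓ).adicCompletion K) ((3 ^ 1 : ℕ) : ℤ) →
      b (Sum.inr (plK ℓ)) (loc (Sum.inr (plK ℓ)) x) (loc (Sum.inr (plK ℓ)) y) ≠ 0)
    -- (Line): the Kummer eigen-line at a Kolyvagin prime
    (hline : ∀ (ℓ : {ℓ // Zhang2014.IsKolyvaginPrime (W.conductorNorm ℤ) W K 3 ℓ}) (s : Bool),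
      ∃ e : galoisCohomology (((W.baseChange K).torsionGaloisModule ((3 ^ 1 : ℕ) : ℤ)).toLocal (Sum.inr (plK ℓ))) 1,
      ∀ x : V3 W K, conjAct W c ((3 ^ 1 : ℕ) : ℤ) x = sgn s • x →
        x ∈ selmerLocalKer (W.baseChange K) ((plK ℓ).adicCompletion K) ((3 ^ 1 : ℕ) : ℤ) →
        ∃ a : ZMod 3, loc (Sum.inr (plK ℓ)) x = a • e)
    -- the level: good, non-empty, carrying a non-zero class
    (n : Finset {q // IsUAdmissiblePrime W K q}) (hg : GoodLevel W K n) (hn : n.Nonempty)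
    (hne : ∃ m, S.κ m n ≠ 0)
    -- (Supply): Zhang's Lemma 8.2 for the level-n structure
    (hSupply : ∀ (ℓ : {ℓ // Zhang2014.IsKolyvaginPrime (W.conductorNorm ℤ) W K 3 ℓ}) (T : Finset _), ℓ ∉ T →
      ∀ s : Bool, ∃ x : V3 W K, conjAct W c ((3 ^ 1 : ℕ) : ℤ) x = sgn s • x ∧ x ≠ 0 ∧
        (∀ w : InfinitePlace K, x ∈ selmerLocalKer (W.baseChange K) w.Completion ((3 ^ 1 : ℕ) : ℤ)) ∧
        (∀ v : HeightOneSpectrum (𝓞 K), v ≠ plK ℓ → (∀ ℓ' ∈ T, plK ℓ' ≠ v) →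
          ((∀ q ∈ n, ((q : ℕ) : 𝓞 K) ∉ v.asIdeal) →
            x ∈ selmerLocalKer (W.baseChange K) (v.adicCompletion K) ((3 ^ 1 : ℕ) : ℤ)) ∧
          (∀ q ∈ n, ((q : ℕ) : 𝓞 K) ∈ v.asIdeal →
            x ∈ (W.baseChange K).ordinaryLocalKer (v.adicCompletion K) ((3 ^ 1 : ℕ) : ℤ))) ∧
        (∀ ℓ' ∈ T, x ∈ transverseLocalKer W K ι ℓ' (plK ℓ'))) :
    ∃ (s : Bool) (d : ℕ), finrank (ZMod 3) (SelQ W K c n s) = d + 1 ∧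
      SelQ W K c n s = SelRelQ W K c n (baseLocusQ W K S.κ n) s ∧
      FiniteDimensional (ZMod 3) (SelRelQ W K c n (baseLocusQ W K S.κ n) (!s)) ∧
      finrank (ZMod 3) (SelRelQ W K c n (baseLocusQ W K S.κ n) (!s)) ≤ d := by
  -- the concrete apparatus: eigenspaces, local conditions as `ZMod 3`-subspaces, the level-`n` structure
  let ρ := (W.baseChange K).torsionGaloisModule ((3 ^ 1 : ℕ) : ℤ)
  let E : Bool → Submodule (ZMod 3) (V3 W K) := fun s ↦
    AddSubgroup.toZModSubmodule 3 (conjAct W c ((3 ^ 1 : ℕ) : ℤ) - sgn s • AddMonoidHom.id (V3 W K)).ker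
  have hE : ∀ (s : Bool) (x : V3 W K), x ∈ E s ↔ conjAct W c ((3 ^ 1 : ℕ) : ℤ) x = sgn s • x :=
    fun s x ↦ mem_eigenSubmodule_iff W K c s x
  let Kum : (v : Place K) → Submodule (ZMod 3) (galoisCohomology (ρ.toLocal v) 1) := fun v ↦
    AddSubgroup.toZModSubmodule 3 ((W.baseChange K).kummerLocalConditionAt ((3 ^ 1 : ℕ) : ℤ) (Place.Completion v))
  let Ord : (v : HeightOneSpectrum (𝓞 K)) → Submodule (ZMod 3) (galoisCohomology (ρ.toLocal (Sum.inr v)) 1) :=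
    fun v ↦ Submodule.map (loc (Sum.inr v))
      (AddSubgroup.toZModSubmodule 3 ((W.baseChange K).ordinaryLocalKer (v.adicCompletion K) ((3 ^ 1 : ℕ) : ℤ)))
  let Tr : (ℓ : {ℓ // Zhang2014.IsKolyvaginPrime (W.conductorNorm ℤ) W K 3 ℓ}) →
      Submodule (ZMod 3) (galoisCohomology (ρ.toLocal (Sum.inr (plK ℓ))) 1) := fun ℓ ↦
    Submodule.map (loc (Sum.inr (plK ℓ))) (AddSubgroup.toZModSubmodule 3 (transverseLocalKer W K ι ℓ (plK ℓ)))
  let L : (v : Place K) → Submodule (ZMod 3) (galoisCohomology (ρ.toLocal v) 1) := fun v ↦ match v with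
    | Sum.inl w => Kum (Sum.inl w)
    | Sum.inr v' => if ∃ q ∈ n, ((q : ℕ) : 𝓞 K) ∈ v'.asIdeal then Ord v' else Kum (Sum.inr v')
  -- per-place dictionaries for the genuine localisations
  have hZero : ∀ (v : HeightOneSpectrum (𝓞 K)) (x : V3 W K),
      x ∈ (W.baseChange K).torsionLocalKer (v.adicCompletion K) ((3 ^ 1 : ℕ) : ℤ) ↔ loc (Sum.inr v) x = 0 := by
    intro v x; rw [hloc]; exact mem_torsionLocalKer_iff_localization_eq_zero W K v x
  have hKumFin : ∀ (v : HeightOneSpectrum (𝓞 K)) (x : V3 W K),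
      x ∈ selmerLocalKer (W.baseChange K) (v.adicCompletion K) ((3 ^ 1 : ℕ) : ℤ) ↔
        loc (Sum.inr v) x ∈ Kum (Sum.inr v) := by
    intro v x
    rw [AddSubgroup.mem_toZModSubmodule, hloc]
    exact mem_selmerLocalKer_iff_localization_mem_kummer W K v x
  have hKumInf : ∀ (w : InfinitePlace K) (x : V3 W K),
      x ∈ selmerLocalKer (W.baseChange K) w.Completion ((3 ^ 1 : ℕ) : ℤ) ↔ loc (Sum.inl w) x ∈ Kum (Sum.inl w) := by
    intro w x
    rw [AddSubgroup.mem_toZModSubmodule, hloc]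
    exact mem_selmerLocalKer_iff_localization_mem_kummer_inf W K w x
  -- a subspace containing the kernel is the preimage of its image (for the linear `loc`)
  have hmap : ∀ (v : HeightOneSpectrum (𝓞 K)) (H : AddSubgroup (V3 W K)),
      (W.baseChange K).torsionLocalKer (v.adicCompletion K) ((3 ^ 1 : ℕ) : ℤ) ≤ H → ∀ x : V3 W K,
      x ∈ H ↔ loc (Sum.inr v) x ∈ Submodule.map (loc (Sum.inr v)) (AddSubgroup.toZModSubmodule 3 H) := by
    intro v H hH x
    refine ⟨fun hx ↦ Submodule.mem_map_of_mem (by rwa [AddSubgroup.mem_toZModSubmodule]), fun hx ↦ ?_⟩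
    obtain ⟨y, hy, hyx⟩ := Submodule.mem_map.mp hx
    rw [AddSubgroup.mem_toZModSubmodule] at hy
    have hk : x - y ∈ (W.baseChange K).torsionLocalKer (v.adicCompletion K) ((3 ^ 1 : ℕ) : ℤ) := by
      rw [hZero, map_sub, hyx, sub_self]
    have := H.add_mem (hH hk) hy
    rwa [sub_add_cancel] at this
  have hOrd : ∀ (v : HeightOneSpectrum (𝓞 K)) (x : V3 W K),
      x ∈ (W.baseChange K).ordinaryLocalKer (v.adicCompletion K) ((3 ^ 1 : ℕ) : ℤ) ↔ loc (Sum.inr v) x ∈ Ord v := by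
    intro v x
    refine hmap v _ (fun y hy ↦ ?_) x
    change (W.baseChange K).torsionLocMap (v.adicCompletion K) _ y = 0 at hy
    change y ∈ AddSubgroup.comap _ _
    rw [AddSubgroup.mem_comap, hy]
    exact AddSubgroup.zero_mem _
  have hTr : ∀ (ℓ : {ℓ // Zhang2014.IsKolyvaginPrime (W.conductorNorm ℤ) W K 3 ℓ}) (x : V3 W K),
      x ∈ transverseLocalKer W K ι ℓ (plK ℓ) ↔ loc (Sum.inr (plK ℓ)) x ∈ Tr ℓ :=
    fun ℓ x ↦ hmap (plK ℓ) _ (torsionLocalKer_le_transverseLocalKer W K ι ℓ (plK ℓ)) x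
  -- the level-`n` structure
  have hLinf : ∀ w : InfinitePlace K, L (Sum.inl w) = Kum (Sum.inl w) := fun w ↦ rfl
  have hLkum : ∀ v : HeightOneSpectrum (𝓞 K), (∀ q ∈ n, ((q : ℕ) : 𝓞 K) ∉ v.asIdeal) →
      L (Sum.inr v) = Kum (Sum.inr v) := by
    intro v hv
    have hneg : ¬ ∃ q ∈ n, ((q : ℕ) : 𝓞 K) ∈ v.asIdeal := fun ⟨q, hq, hqv⟩ ↦ hv q hq hqv
    show (if ∃ q ∈ n, ((q : ℕ) : 𝓞 K) ∈ v.asIdeal then Ord v else Kum (Sum.inr v)) = Kum (Sum.inr v)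
    rw [if_neg hneg]
  have hLord : ∀ v : HeightOneSpectrum (𝓞 K), ∀ q ∈ n, ((q : ℕ) : 𝓞 K) ∈ v.asIdeal → L (Sum.inr v) = Ord v := by
    intro v q hq hqv
    show (if ∃ q ∈ n, ((q : ℕ) : 𝓞 K) ∈ v.asIdeal then Ord v else Kum (Sum.inr v)) = Ord v
    rw [if_pos ⟨q, hq, hqv⟩]
  -- isotropy of the level-`n` structure (ordinary isotropy only above the GOOD primes of `n`) and of the transverse conditions
  have hisoL : ∀ (v : Place K), ∀ x ∈ L v, ∀ y ∈ L v, b v x y = 0 := by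
    intro v x hx y hy
    rcases v with w | v
    · change x ∈ AddSubgroup.toZModSubmodule 3 _ at hx
      change y ∈ AddSubgroup.toZModSubmodule 3 _ at hy
      rw [AddSubgroup.mem_toZModSubmodule] at hx hy
      exact hisoKum (Sum.inl w) x hx y hy
    · by_cases h : ∃ q ∈ n, ((q : ℕ) : 𝓞 K) ∈ v.asIdeal
      · obtain ⟨q, hq, hqv⟩ := h
        rw [hLord v q hq hqv] at hx hy
        obtain ⟨x', hx', rfl⟩ := Submodule.mem_map.mp hx
        obtain ⟨y', hy', rfl⟩ := Submodule.mem_map.mp hy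
        rw [AddSubgroup.mem_toZModSubmodule] at hx' hy'
        exact hisoOrd q (hg q hq) v hqv x' y' hx' hy'
      · push Not at h
        rw [hLkum v h] at hx hy
        change x ∈ AddSubgroup.toZModSubmodule 3 _ at hx
        change y ∈ AddSubgroup.toZModSubmodule 3 _ at hy
        rw [AddSubgroup.mem_toZModSubmodule] at hx hy
        exact hisoKum (Sum.inr v) x hx y hy
  have hisoT : ∀ (ℓ : {ℓ // Zhang2014.IsKolyvaginPrime (W.conductorNorm ℤ) W K 3 ℓ}), ∀ x ∈ Tr ℓ, ∀ y ∈ Tr ℓ,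
      b (Sum.inr (plK ℓ)) x y = 0 := by
    intro ℓ x hx y hy
    obtain ⟨x', hx', rfl⟩ := Submodule.mem_map.mp hx
    obtain ⟨y', hy', rfl⟩ := Submodule.mem_map.mp hy
    rw [AddSubgroup.mem_toZModSubmodule] at hx' hy'
    exact hisoTr ℓ x' y' hx' hy'
  -- (Perf) and (Line) in engine currency
  have hperf' : ∀ (ℓ : {ℓ // Zhang2014.IsKolyvaginPrime (W.conductorNorm ℤ) W K 3 ℓ}) (s : Bool),
      ∀ x ∈ E s, ∀ y ∈ E s, loc (Sum.inr (plK ℓ)) x ∈ Kum (Sum.inr (plK ℓ)) → loc (Sum.inr (plK ℓ)) x ≠ 0 →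
      loc (Sum.inr (plK ℓ)) y ∈ Tr ℓ → loc (Sum.inr (plK ℓ)) y ≠ 0 →
      b (Sum.inr (plK ℓ)) (loc (Sum.inr (plK ℓ)) x) (loc (Sum.inr (plK ℓ)) y) ≠ 0 := by
    intro ℓ s x hx y hy hxK hx0 hyT hy0
    refine hperf ℓ s x y ((hE s x).mp hx) ((hE s y).mp hy) ((hKumFin _ x).mpr hxK)
      (fun h ↦ hx0 ((hZero _ x).mp h)) ((hTr ℓ y).mpr hyT) (fun h ↦ hy0 ((hZero _ y).mp h))
  have hline' : ∀ (ℓ : {ℓ // Zhang2014.IsKolyvaginPrime (W.conductorNorm ℤ) W K 3 ℓ}) (s : Bool),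
      ∃ e : galoisCohomology (ρ.toLocal (Sum.inr (plK ℓ))) 1, ∀ x ∈ E s,
      loc (Sum.inr (plK ℓ)) x ∈ Kum (Sum.inr (plK ℓ)) → ∃ a : ZMod 3, loc (Sum.inr (plK ℓ)) x = a • e := by
    intro ℓ s
    obtain ⟨e, he⟩ := hline ℓ s
    exact ⟨e, fun x hx hxK ↦ he x ((hE s x).mp hx) ((hKumFin _ x).mpr hxK)⟩
  -- (Cheb) ×2 from McCallum's Cor. 3.2
  have hCheb1 := cheb_one_of_mcCallum W K c hK hmult hsurj hc loc plK hplK hZero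
  have hCheb2 := cheb_two_of_mcCallum W K c hK hmult hsurj hc loc E plK hplK hE hZero
  -- (Supply) in engine currency, at the level `n`
  have hSupply' : ∀ (ℓ : {ℓ // Zhang2014.IsKolyvaginPrime (W.conductorNorm ℤ) W K 3 ℓ}) (T : Finset _), ℓ ∉ T →
      ∀ s : Bool, ∃ x ∈ E s, x ≠ 0 ∧
        (∀ v : Place K, v ≠ Sum.inr (plK ℓ) → (∀ ℓ' ∈ T, Sum.inr (plK ℓ') ≠ v) → loc v x ∈ L v) ∧
        ∀ ℓ' ∈ T, loc (Sum.inr (plK ℓ')) x ∈ Tr ℓ' := by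
    intro ℓ T hℓT s
    obtain ⟨x, hxs, hx0, hinf, hfin, htr⟩ := hSupply ℓ T hℓT s
    refine ⟨x, (hE s x).mpr hxs, hx0, fun v hv hvT ↦ ?_, fun ℓ' hℓ' ↦ (hTr ℓ' x).mp (htr ℓ' hℓ')⟩
    rcases v with w | v
    · show loc (Sum.inl w) x ∈ Kum (Sum.inl w)
      exact (hKumInf w x).mp (hinf w)
    · have hv' : v ≠ plK ℓ := fun h ↦ hv (by rw [h])
      have hvT' : ∀ ℓ' ∈ T, plK ℓ' ≠ v := fun ℓ' hℓ'T h ↦ hvT ℓ' hℓ'T (by rw [h])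
      obtain ⟨hk, ho⟩ := hfin v hv' hvT'
      by_cases h : ∃ q ∈ n, ((q : ℕ) : 𝓞 K) ∈ v.asIdeal
      · obtain ⟨q, hq, hqv⟩ := h
        rw [hLord v q hq hqv]; exact (hOrd v x).mp (ho q hq hqv)
      · push Not at h
        rw [hLkum v h]; exact (hKumFin v x).mp (hk h)
  -- uniqueness of the places above the inert primes (a non-zero prime of a Dedekind domain is maximal)
  have huniq : ∀ {q : ℕ}, (Ideal.span {(q : 𝓞 K)}).IsPrime → q ≠ 0 → ∀ {v v' : HeightOneSpectrum (𝓞 K)},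
      (q : 𝓞 K) ∈ v.asIdeal → (q : 𝓞 K) ∈ v'.asIdeal → v' = v := by
    intro q hq hq0 v v' hv hv'
    have key : ∀ w : HeightOneSpectrum (𝓞 K), (q : 𝓞 K) ∈ w.asIdeal → w.asIdeal = Ideal.span {(q : 𝓞 K)} := by
      intro w hw
      have hle : Ideal.span {(q : 𝓞 K)} ≤ w.asIdeal := by
        rw [Ideal.span_le, Set.singleton_subset_iff]
        exact hw
      have hne' : Ideal.span {(q : 𝓞 K)} ≠ ⊥ := by
        rw [Ne, Ideal.span_singleton_eq_bot]
        exact_mod_cast hq0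
      exact ((hq.isMaximal hne').eq_of_le w.isPrime.ne_top hle).symm
    exact HeightOneSpectrum.ext (by rw [key v hv, key v' hv'])
  have hKuniq : ∀ (ℓ : {ℓ // Zhang2014.IsKolyvaginPrime (W.conductorNorm ℤ) W K 3 ℓ}) (v : HeightOneSpectrum (𝓞 K)),
      ((ℓ : ℕ) : 𝓞 K) ∈ v.asIdeal → v = plK ℓ :=
    fun ℓ v hv ↦ huniq ℓ.2.2.2.2.2.1 ℓ.2.1.ne_zero (hplK ℓ) hv
  have hUuniq : ∀ (q : {q // IsUAdmissiblePrime W K q}) (v : HeightOneSpectrum (𝓞 K)),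
      ((q : ℕ) : 𝓞 K) ∈ v.asIdeal → v = plU q :=
    fun q v hv ↦ huniq q.2.2.2.2.2.1 q.2.1.ne_zero (hplU q) hv
  -- membership dictionary for the canonical space at the level `n`
  have hSel : ∀ (s : Bool) (x : V3 W K), x ∈ SelQ W K c n s ↔ x ∈ E s ∧ ∀ v, loc v x ∈ L v := by
    intro s x
    rw [mem_selQ_iff, hE]
    refine and_congr_right fun _ ↦ ⟨fun ⟨hinf, hfin, hord⟩ v ↦ ?_, fun h ↦ ⟨fun w ↦ ?_, fun v hv ↦ ?_,
      fun q hq v hv ↦ ?_⟩⟩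
    · rcases v with w | v
      · rw [hLinf]; exact (hKumInf w x).mp (hinf w)
      · by_cases hv : ∃ q ∈ n, ((q : ℕ) : 𝓞 K) ∈ v.asIdeal
        · obtain ⟨q, hq, hqv⟩ := hv
          rw [hLord v q hq hqv]; exact (hOrd v x).mp (hord q hq v hqv)
        · push Not at hv
          rw [hLkum v hv]; exact (hKumFin v x).mp (hfin v hv)
    · have := h (Sum.inl w); rw [hLinf] at this; exact (hKumInf w x).mpr this
    · have := h (Sum.inr v); rw [hLkum v hv] at this; exact (hKumFin v x).mpr this
    · have := h (Sum.inr v); rw [hLord v q hq hv] at this; exact (hOrd v x).mpr this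
  -- membership dictionary for the space relaxed at the base locus of the level `n`
  have hSelRel : ∀ (s : Bool) (x : V3 W K),
      x ∈ SelRelQ W K c n (baseLocusQ W K S.κ n) s ↔
        x ∈ E s ∧ ∀ v, v ∉ (fun q ↦ (Sum.inr (plU q) : Place K)) '' baseLocusQ W K S.κ n → loc v x ∈ L v := by
    intro s x
    rw [mem_selRelQ_iff, hE]
    refine and_congr_right fun _ ↦ ⟨fun ⟨hinf, hfin, hord⟩ v hvB ↦ ?_, fun h ↦ ⟨fun w ↦ ?_, fun v hv hvS ↦ ?_,
      fun q hq hqS v hv ↦ ?_⟩⟩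
    · rcases v with w | v
      · rw [hLinf]; exact (hKumInf w x).mp (hinf w)
      · by_cases hv : ∃ q ∈ n, ((q : ℕ) : 𝓞 K) ∈ v.asIdeal
        · obtain ⟨q, hq, hqv⟩ := hv
          have hqS : q ∉ baseLocusQ W K S.κ n := fun h ↦ hvB ⟨q, h, by rw [hUuniq q v hqv]⟩
          rw [hLord v q hq hqv]; exact (hOrd v x).mp (hord q hq hqS v hqv)
        · push Not at hv
          have hvS : ∀ q ∈ baseLocusQ W K S.κ n, ((q : ℕ) : 𝓞 K) ∉ v.asIdeal :=
            fun q hq hqv ↦ hvB ⟨q, hq, by rw [hUuniq q v hqv]⟩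
          rw [hLkum v hv]; exact (hKumFin v x).mp (hfin v hv hvS)
    · have := h (Sum.inl w) (by rintro ⟨q, -, hq⟩; exact Sum.inr_ne_inl hq)
      rw [hLinf] at this; exact (hKumInf w x).mpr this
    · have := h (Sum.inr v) (by
        rintro ⟨q, hq, hqv⟩
        exact hvS q hq ((Sum.inr_injective hqv) ▸ hplU q))
      rw [hLkum v hv] at this; exact (hKumFin v x).mpr this
    · have := h (Sum.inr v) (by
        rintro ⟨q', hq', hq'v⟩
        have hvq' : v = plU q' := (Sum.inr_injective hq'v).symm
        have hqq' : q = q' := by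
          by_contra hne'
          have hcop : Nat.Coprime (q' : ℕ) (q : ℕ) := (Nat.coprime_primes q'.2.1 q.2.1).mpr
            (fun h ↦ hne' (Subtype.ext h.symm))
          exact not_mem_asIdeal_of_coprime K hcop v (hvq' ▸ hplU q') hv
        exact hqS (hqq' ▸ hq'))
      rw [hLord v q hq hv] at this; exact (hOrd v x).mpr this
  -- the classes vanish on the base locus
  have hB : ∀ v ∈ (fun q ↦ (Sum.inr (plU q) : Place K)) '' baseLocusQ W K S.κ n, ∀ m, loc v (S.κ m n) = 0 := by
    rintro v ⟨q, hq, rfl⟩ m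
    exact (hZero (plU q) _).mp (hq m (plU q) (hplU q))
  -- the Kolyvagin places are pairwise distinct and carry the Kummer condition at the level `n`
  have hpl : Function.Injective (fun ℓ ↦ (Sum.inr (plK ℓ) : Place K)) := by
    intro ℓ ℓ' h
    have h' : plK ℓ = plK ℓ' := Sum.inr_injective h
    by_contra hne'
    have hcop : Nat.Coprime (ℓ : ℕ) (ℓ' : ℕ) := (Nat.coprime_primes ℓ.2.1 ℓ'.2.1).mpr (fun h ↦ hne' (Subtype.ext h))
    exact not_mem_asIdeal_of_coprime K hcop (plK ℓ) (hplK ℓ) (h' ▸ hplK ℓ')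
  have hLF : ∀ ℓ, L (Sum.inr (plK ℓ)) = Kum (Sum.inr (plK ℓ)) := fun ℓ ↦
    hLkum (plK ℓ) fun q _ ↦ not_mem_of_kolyvagin_place W K q.2 ℓ.2 (plK ℓ) (hplK ℓ)
  -- the Kolyvagin-system readings of the classes at the level `n`
  have hcE : ∀ m, S.κ m n ∈ E (S.ε₀ n ^^ Nat.bodd m.card) := fun m ↦ (hE _ _).mpr (S.sign n hg hn m)
  have hcL : ∀ m (v : Place K), (∀ ℓ ∈ m, (Sum.inr (plK ℓ) : Place K) ≠ v) → loc v (S.κ m n) ∈ L v := by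
    intro m v hv
    rcases v with w | v
    · rw [hLinf]; exact (hKumInf w _).mp (S.selmer_inf n hg hn m w)
    · by_cases hvn : ∃ q ∈ n, ((q : ℕ) : 𝓞 K) ∈ v.asIdeal
      · obtain ⟨q, hq, hqv⟩ := hvn
        rw [hLord v q hq hqv]; exact (hOrd v _).mp (S.ordinary_on n hg hn m q hq v hqv)
      · push Not at hvn
        have hvm : ∀ ℓ ∈ m, ((ℓ : ℕ) : 𝓞 K) ∉ v.asIdeal := fun ℓ hℓ hℓv ↦ hv ℓ hℓ (by rw [hKuniq ℓ v hℓv])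
        rw [hLkum v hvn]; exact (hKumFin v _).mp (S.selmer_off n hg hn m v hvm hvn)
  have hcT : ∀ m, ∀ ℓ ∈ m, loc (Sum.inr (plK ℓ)) (S.κ m n) ∈ Tr ℓ :=
    fun m ℓ hℓ ↦ (hTr ℓ _).mp (S.transverse_on n hg hn m ℓ hℓ (plK ℓ) (hplK ℓ))
  have hfs : ∀ m ℓ, ℓ ∉ m →
      (loc (Sum.inr (plK ℓ)) (S.κ (insert ℓ m) n) = 0 ↔ loc (Sum.inr (plK ℓ)) (S.κ m n) = 0) := by
    intro m ℓ hℓ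
    rw [← hZero, ← hZero]
    exact S.relation n hg hn m ℓ hℓ (plK ℓ) (hplK ℓ)
  -- Zhang's Lemma 8.4 (1)+(3) for the system `S.κ(·, n)` and the structure `L` (finiteness included)
  exact ZhangTriangulation.triangulation_finite E loc b L (fun ℓ ↦ Sum.inr (plK ℓ)) (fun ℓ ↦ Kum (Sum.inr (plK ℓ))) Tr
    (fun m ↦ S.κ m n) (S.ε₀ n) ((fun q ↦ (Sum.inr (plU q) : Place K)) '' baseLocusQ W K S.κ n) (SelQ W K c n)
    (SelRelQ W K c n (baseLocusQ W K S.κ n)) hSel hSelRel hB hpl hLF hisoL hisoT hperf' hline' hrec hcE hcL hcT hfs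
    hCheb1 hCheb2 hSupply' hne

end Summit.BirchSwinnertonDyer.Rank1Residual.X11b.Three.Koly.Method2

end
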